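import Summits.QuantumFields.BalabanUV.Beta.D1BFx.PeriodicArraySuperpositionTorus
import Summits.QuantumFields.BalabanUV.Beta.D1BFx.PeriodicArrayBiSuperposition
import Summits.QuantumFields.BalabanUV.Beta.D1BFx.PeriodicArrayWrapLimit

/-!
# `BalabanUV.Beta.D1BFx.PeriodicArrayPackingPlain` — road «BF-x» for binder row D1, slot (K), chain step (I) «(A1)-PACKED», brick (B5)
# «GRAM-COV-PACKED» ∕ «FP-PACKED-LIMIT», FILE 1 «PACK-PLAIN»: **THE PLAIN-CURRENCY TWIN OF (B4c)** — on the fine torus of period `s = n·p`,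
# the fibrewise periodisation `(arr s ·)^ := Matrix.of (periodiseF s (toF (arr s ·)))` of a DIRECTION-SUMMED weighted superposition
# `Σ_κ wsum (w κ) (S κ)` of self-localised, PERIOD-covariant stencils is the RESPONSE-WEIGHTED finite sum, over the torus' fine bonds
# `k = (z̄, (ẑ, κ′)) : I d n p`, of the periodisations of the single-bond stencils; and its DIAGONAL second-order reading, with ONE weight PERIODISED
# (FINDING F-g16-1 «WRAP» in its bond-diagonal form), together with the `s`-uniform localisation and the entrywise `s → ∞` limit of that family

HONEST DEPENDENCY (cell records, verbatim): «continuum YM on T⁴ ⇐ BetaPertH ∧ nine spine estimates (0/9 proved); BetaPertH ⇐ (D1) ∧ (D4) ∧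
CAP+tail; G-an2-4 gates asym, D1 and NE2/3/4.»  HONEST FRAMING (cell contract, verbatim): «discharging `BetaPertH` makes Bałaban's UV stability
UNCONDITIONAL — a real constructive-QFT result; it is NOT the continuum limit and NOT the Clay problem.»  THIS MODULE DISCHARGES NOTHING of (K),
of D1 or of the wall: [folklore] absolutely convergent `ℤ^D` ∕ torus bookkeeping BY NAME over (B4) `PeriodicArraySuperposition`
(`arr_finset_sum_apply`), (B4d) `PeriodicArrayBiSuperposition` (`arr_wsum_eq_sum_window_left`, `abs_periodisedWeight_le`, `periodisedWeight_periodic`),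
(B4c) `PeriodicArraySuperpositionTorus.periodiseF_finset_sum`, gan24-leaf-05's «WRAP-LIMIT» `PeriodicArrayWrapLimit.tendsto_tsum_images`,
`OneStepResolventKernel.biLoc_wsum` and Mathlib's dominated convergence for series.  No definition, no `def … : Prop`, nothing cited, 0 sorry.
0 root-level binders of row D1 discharged; (K) NOT closed; NOT D1, NOT `BetaPertH`, NOT continuum, NOT Clay.

ABSOLUTE RULE (cell charter, verbatim): «No internally-minted statement may enter as a cited fact. Every hypothesis is either kernel-proved in this
package or a verbatim quotation of a PUBLISHED theorem with page reference. The manuscript(s) under audit are NOT citable for their own disputed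
steps — they are the thing under adjudication; programme-internal (2001/route/tribunal) claims are never citable.»

WHY (road owner d1-p2's `A1-PACKED-SPEC.md` v0.3.1 §6∕§8, brick (B5)).  The two TOWER SLOTS of `KCombineCovColourTorus.identity_array_currency_cov_What0_stripped`
(«GRAM-COV», «COMB-FP») are, at RESPONSE-PACKED jets, `Σ_{k,l} rₛ k·rₜ l`-superpositions of their single-bond-pair values (owner's «SLOT-PACK»); the
single-pair values are torus one-loop functionals of the periodised arrays of FIXED `ℤ⁴` word families (`nFcol`, `Lgh`, …; this lineage's gen 11);
re-packing the superposition needs exactly this file's identities in the PLAIN periodisation currency (the tower words have scalar fibre `Unit` and are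
NOT sorted) — (B4c) is the SORTED-currency analogue for the M∕N tables.  The word families of the towers are covariant under BLOCK translations only
(the comb functions see the block partition), which is why the hypotheses ask for covariance under PERIOD translates `s·m` (`s = n·p`) and no more.

CONTENT (generic dimension `d+1`, fibre `F`; torus `n`, `p`, `s = n·p`; bond index `k = (z̄, (ẑ, κ′)) : I d n p`, `ŵ_k := windowMap s (torusBlockEquiv n p (z̄, ẑ))`,
responses `r k := Σ'_m w κ′_k (ŵ_k + s·m)`; all [folklore]).
* §1 `abs_le_left_of_biLoc`, `arr_const_mul_apply`, `summable_images_arr_fib`, `sum_bond_reindex`.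
* §2 first order: `biLoc_dirsum_wsum`, **`arr_dirsum_wsum_apply`** (`arr s (Σ_κ wsum (w κ) (S κ)) x y a b = Σ_k r k · arr s (S κ′_k ŵ_k) x y a b`),
  **`periodiseF_toF_arr_dirsum_wsum`** (`(arr s (Σ_κ wsum (w κ) (S κ)))^ = Σ_k r k • (arr s (S κ′_k ŵ_k))^`).
* §3 diagonal second order (one weight periodised): `biLoc_dirsum_wsum_per` (`s`-free constant), **`arr_dirsum_wsum_per_apply`**,
  **`periodiseF_toF_arr_dirsum_wsum_per`** (`(arr s (Σ_κ wsum (w κ) (u ↦ w′_perˢ κ u · S κ u)))^ = Σ_k (r k·r′ k) • (arr s (S κ′_k ŵ_k))^`).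
* §4 the limit of the diagonal family: `biLoc_dirsum_wsum_mul`, **`tendsto_dirsum_wsum_per_apply`** (entrywise, along any `σ k → ∞`:
  `Σ_κ wsum (w κ) (u ↦ w′_per^{σ k} κ u · S κ u) → Σ_κ wsum (w κ) (u ↦ w′ κ u · S κ u)`).
Unit `b2b-balaban-beta-d1-formalise-leaf-03` (gen 22); road owner `b2b-balaban-beta-d1-p2`.
-/

noncomputable section

namespace Summit.QuantumFields.BalabanUV.Beta.D1BFx.PeriodicArrayPackingPlain

open Matrix Filter Topology
open scoped BigOperators
open Literature.Probability.LatticeModels (TorusSite)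
open Literature.MathematicalPhysics.QuantumFieldTheory.Balaban1983to89
open Literature.MathematicalPhysics.QuantumFieldTheory.Balaban1983to89.Beta
open B12Sec2to5 (l1 l1_nonneg)
open ExpKernelCalculus (MKer BiLoc shiftK Zl Zl_pos Zl_nonneg summable_exp_shift summable_exp_shift' tsum_exp_shift)
open OneStepResolventKernel (wsum biLoc_wsum abs_wsumTerm_le summable_wsumTerm)
open Summit.QuantumFields.BalabanUV.Beta.D1BFx.FibredPeriodisation (FKer periodiseF periodiseF_apply Kfib)
open Summit.QuantumFields.BalabanUV.Beta.D1BFx.SortedReblocking (torusBlockEquiv)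
open Summit.QuantumFields.BalabanUV.Beta.D1BFx.PeriodicArrays (arr arr_apply toF summable_abs_row_arr summable_arr_term bdd_arr)
open Summit.QuantumFields.BalabanUV.Beta.D1BFx.PeriodicArraySuperposition (arr_finset_sum_apply)
open Summit.QuantumFields.BalabanUV.Beta.D1BFx.PeriodicArrayBiSuperposition (arr_wsum_eq_sum_window_left abs_periodisedWeight_le
  periodisedWeight_periodic)
open Summit.QuantumFields.BalabanUV.Beta.D1BFx.PeriodicArraySuperpositionTorus (periodiseF_finset_sum)
open Summit.QuantumFields.BalabanUV.Beta.D1BFx.PeriodicArrayWrapLimit (const_nonneg_of_weight tendsto_tsum_images)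

variable {d : ℕ} {F : Type*} {n p : ℕ} [NeZero n] [NeZero p]

/-! ## §1 Helpers -/

section Helpers

omit [NeZero n] [NeZero p] in
/-- [folklore] A kernel bi-localised at `(u, q)` is LEFT-localised at `u` with the same constant (drop the second factor). -/
theorem abs_le_left_of_biLoc {K : MKer (d + 1) F} {u q : Fin (d + 1) → ℤ} {C δ : ℝ} (hK : BiLoc K u q C δ) (hδ : 0 ≤ δ)
    (x y : Fin (d + 1) → ℤ) (a b : F) : |K x y a b| ≤ C * Real.exp (-δ * l1 (x - u)) := by
  refine (hK x y a b).trans (mul_le_mul_of_nonneg_left (Real.exp_le_exp.2 ?_) (hK.nonneg a))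
  nlinarith [l1_nonneg (y - q)]

omit [NeZero n] [NeZero p] in
/-- [folklore] A scalar passes through the array: `arr s (c·V) x y a b = c · arr s V x y a b`. -/
theorem arr_const_mul_apply (s : ℕ) (c : ℝ) (V : MKer (d + 1) F) (x y : Fin (d + 1) → ℤ) (a b : F) :
    arr s (fun x y a b => c * V x y a b) x y a b = c * arr s V x y a b := by
  simp only [arr_apply]
  exact tsum_mul_left

omit [NeZero n] [NeZero p] in
/-- [folklore] The image rows of the array of a bi-localised kernel are summable (any fibre; (B4c)'s `summable_images_arr` at `Fib d`). -/
theorem summable_images_arr_fib {V : MKer (d + 1) F} {P Q : Fin (d + 1) → ℤ} {C δ : ℝ} (hV : BiLoc V P Q C δ) (hδ : 0 < δ)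
    (s : ℕ) [NeZero s] (a b : F) (x w : Fin (d + 1) → ℤ) : Summable fun t => arr s V x (imageShift s w t) a b :=
  summable_row_imageShift (K := Kfib (toF (arr s V)) a b) (fun x => (summable_abs_row_arr hV hδ s a b x).of_abs) x w

/-- [folklore] **RE-INDEXING THE TORUS' FINE BONDS**: `Σ_{k : I d n p} f κ′_k (torusBlockEquiv (z̄_k, ẑ_k)) = Σ_κ Σ_{zz : Site (d+1) (n·p)} f κ zz` (along
`k ↦ (κ′_k, torusBlockEquiv (z̄_k, ẑ_k))`, (B4c)'s equivalence). -/
theorem sum_bond_reindex {M : Type*} [AddCommMonoid M] (f : Fin (d + 1) → Beta.Site (d + 1) (n * p) → M) :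
    ∑ k : Beta.Site (d + 1) p × (TorusSite (d + 1) n × Fin (d + 1)), f k.2.2 (torusBlockEquiv n p (k.1, k.2.1))
      = ∑ κ : Fin (d + 1), ∑ zz : Beta.Site (d + 1) (n * p), f κ zz := by
  let e : Beta.Site (d + 1) p × (TorusSite (d + 1) n × Fin (d + 1)) ≃ Fin (d + 1) × Beta.Site (d + 1) (n * p) :=
    { toFun := fun k => (k.2.2, torusBlockEquiv n p (k.1, k.2.1))
      invFun := fun q => (((torusBlockEquiv n p).symm q.2).1, (((torusBlockEquiv n p).symm q.2).2, q.1))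
      left_inv := fun k => by simp
      right_inv := fun q => by simp }
  rw [← Fintype.sum_prod_type']
  exact Fintype.sum_equiv e _ (fun q : Fin (d + 1) × Beta.Site (d + 1) (n * p) => f q.1 q.2) (fun k => rfl)

end Helpers

/-! ## §2 First order: the direction-summed weighted superposition -/

section First

variable {w : Fin (d + 1) → (Fin (d + 1) → ℤ) → ℝ} {S : Fin (d + 1) → (Fin (d + 1) → ℤ) → MKer (d + 1) F} {C Cs δ : ℝ}
  {P : Fin (d + 1) → ℤ}

omit [NeZero n] [NeZero p] in
/-- [folklore] LOCALISATION: `Σ_κ wsum (w κ) (S κ)` is bi-localised at the centre `P` of the weights (rate `δ∕2`, constant `(d+1)·C·Cs·Zl (δ∕2)`). -/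
theorem biLoc_dirsum_wsum (hw : ∀ κ u, |w κ u| ≤ C * Real.exp (-δ * l1 (u - P))) (hS : ∀ κ u, BiLoc (S κ u) u u Cs δ) (hδ : 0 < δ)
    (hC : 0 ≤ C) :
    BiLoc (fun x y a b => ∑ κ : Fin (d + 1), wsum (w κ) (S κ) x y a b) P P (∑ _κ : Fin (d + 1), C * Cs * Zl (d + 1) (δ / 2)) (δ / 2) :=
  OneStepResolventKernel.biLoc_finset_sum Finset.univ fun κ _ => biLoc_wsum (hw κ) (hS κ) hδ hC

/-- [folklore] **FIRST ORDER, ENTRYWISE**: for decaying direction-indexed weights (`|w κ u| ≤ C·e^{−δ|u−P|₁}`), self-localised stencils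
(`BiLoc (S κ u) u u Cs δ`) covariant under PERIOD translates (`S κ (u + s·m) = shiftK (−s·m) (S κ u)`, `s = n·p`):
`arr s (Σ_κ wsum (w κ) (S κ)) x y a b = Σ_{k : I d n p} (Σ'_m w κ′_k (ŵ_k + s·m)) · arr s (S κ′_k ŵ_k) x y a b`. -/
theorem arr_dirsum_wsum_apply (hw : ∀ κ u, |w κ u| ≤ C * Real.exp (-δ * l1 (u - P))) (hS : ∀ κ u, BiLoc (S κ u) u u Cs δ)
    (hScov : ∀ κ u m, S κ (imageShift (n * p) u m) = shiftK (-(((n * p : ℕ) : ℤ) • m)) (S κ u)) (hδ : 0 < δ) (hC : 0 ≤ C)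
    (x y : Fin (d + 1) → ℤ) (a b : F) :
    arr (n * p) (fun x y a b => ∑ κ : Fin (d + 1), wsum (w κ) (S κ) x y a b) x y a b
      = ∑ k : Beta.Site (d + 1) p × (TorusSite (d + 1) n × Fin (d + 1)),
          (∑' m : Fin (d + 1) → ℤ, w k.2.2 (imageShift (n * p) (windowMap (d + 1) (n * p) (torusBlockEquiv n p (k.1, k.2.1))) m))
            * arr (n * p) (S k.2.2 (windowMap (d + 1) (n * p) (torusBlockEquiv n p (k.1, k.2.1)))) x y a b := by
  have hCs : 0 ≤ Cs := (hS 0 0).nonneg a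
  rw [arr_finset_sum_apply Finset.univ (fun κ _ => biLoc_wsum (hw κ) (hS κ) hδ hC) (half_pos hδ) (n * p) x y a b,
    sum_bond_reindex (fun κ zz => (∑' m : Fin (d + 1) → ℤ, w κ (imageShift (n * p) (windowMap (d + 1) (n * p) zz) m))
      * arr (n * p) (S κ (windowMap (d + 1) (n * p) zz)) x y a b)]
  exact Finset.sum_congr rfl fun κ _ =>
    arr_wsum_eq_sum_window_left (s := n * p) (hw κ) (fun u x y a b => abs_le_left_of_biLoc (hS κ u) hδ.le x y a b) (hScov κ) hδ hC hCs
      x y a b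

/-- [folklore] **FIRST ORDER, TORUS-MATRIX FORM — «PACK-PLAIN»**: under the same hypotheses,
`(arr s (Σ_κ wsum (w κ) (S κ)))^ = Σ_{k : I d n p} (Σ'_m w κ′_k (ŵ_k + s·m)) • (arr s (S κ′_k ŵ_k))^`, `(·)^ := Matrix.of ∘ periodiseF s ∘ toF`
— the periodised packed word is the RESPONSE-WEIGHTED sum, over the torus' fine bonds, of the periodised single-bond words (plain-currency twin of
(B4c) `blocksHat_sortK_arr_vertexOfK`). -/
theorem periodiseF_toF_arr_dirsum_wsum (hw : ∀ κ u, |w κ u| ≤ C * Real.exp (-δ * l1 (u - P))) (hS : ∀ κ u, BiLoc (S κ u) u u Cs δ)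
    (hScov : ∀ κ u m, S κ (imageShift (n * p) u m) = shiftK (-(((n * p : ℕ) : ℤ) • m)) (S κ u)) (hδ : 0 < δ) (hC : 0 ≤ C) :
    Matrix.of (periodiseF (n * p) (toF (arr (n * p) (fun x y a b => ∑ κ : Fin (d + 1), wsum (w κ) (S κ) x y a b))))
      = ∑ k : Beta.Site (d + 1) p × (TorusSite (d + 1) n × Fin (d + 1)),
          (∑' m : Fin (d + 1) → ℤ, w k.2.2 (imageShift (n * p) (windowMap (d + 1) (n * p) (torusBlockEquiv n p (k.1, k.2.1))) m))
            • Matrix.of (periodiseF (n * p) (toF (arr (n * p) (S k.2.2 (windowMap (d + 1) (n * p) (torusBlockEquiv n p (k.1, k.2.1))))))) := by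
  ext ⟨x, a⟩ ⟨y, b⟩
  rw [Matrix.sum_apply]
  simp only [Matrix.smul_apply, smul_eq_mul, Matrix.of_apply]
  exact periodiseF_finset_sum Finset.univ _
    (Li := fun k : Beta.Site (d + 1) p × (TorusSite (d + 1) n × Fin (d + 1)) =>
      toF (arr (n * p) (S k.2.2 (windowMap (d + 1) (n * p) (torusBlockEquiv n p (k.1, k.2.1))))))
    (fun I J => arr_dirsum_wsum_apply hw hS hScov hδ hC I.1 J.1 I.2 J.2)
    (fun (k : Beta.Site (d + 1) p × (TorusSite (d + 1) n × Fin (d + 1))) _ a b x w =>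
      summable_images_arr_fib (hS k.2.2 (windowMap (d + 1) (n * p) (torusBlockEquiv n p (k.1, k.2.1)))) hδ (n * p) a b x w) x y a b

end First

/-! ## §3 Diagonal second order: one weight periodised -/

section Diagonal

variable {w w' : Fin (d + 1) → (Fin (d + 1) → ℤ) → ℝ} {S : Fin (d + 1) → (Fin (d + 1) → ℤ) → MKer (d + 1) F} {C C' Cs δ : ℝ}
  {P P' : Fin (d + 1) → ℤ}

omit [NeZero n] [NeZero p] in
/-- [folklore] The stencil weighted by the PERIODISED second weight, `u ↦ (Σ'_m w′ κ (u + s·m)) · S κ u`, is self-localised with the `s`-FREE constant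
`C′·Zl (d+1) δ·Cs` (the periodised weight is bounded, `abs_periodisedWeight_le`). -/
theorem biLoc_per_mul (hw' : ∀ κ u, |w' κ u| ≤ C' * Real.exp (-δ * l1 (u - P'))) (hS : ∀ κ u, BiLoc (S κ u) u u Cs δ) (hδ : 0 < δ)
    (s : ℕ) [NeZero s] (κ : Fin (d + 1)) (u : Fin (d + 1) → ℤ) :
    BiLoc (fun x y a b => (∑' m : Fin (d + 1) → ℤ, w' κ (imageShift s u m)) * S κ u x y a b) u u (C' * Zl (d + 1) δ * Cs) δ := by
  intro x y a b
  rw [abs_mul, mul_assoc]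
  exact mul_le_mul (abs_periodisedWeight_le (hw' κ) hδ (const_nonneg_of_weight (hw' κ)) u) (hS κ u x y a b) (abs_nonneg _)
    (mul_nonneg (const_nonneg_of_weight (hw' κ)) (Zl_nonneg hδ))

omit [NeZero n] [NeZero p] in
/-- [folklore] LOCALISATION OF THE DIAGONAL FAMILY, UNIFORMLY IN THE PERIOD: `Σ_κ wsum (w κ) (u ↦ w′_perˢ κ u · S κ u)` is bi-localised at `(P, P)`
with constant `(d+1)·C·(C′·Zl δ·Cs)·Zl (δ∕2)` at rate `δ∕2`, for every `s ≥ 1`. -/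
theorem biLoc_dirsum_wsum_per (hw : ∀ κ u, |w κ u| ≤ C * Real.exp (-δ * l1 (u - P))) (hw' : ∀ κ u, |w' κ u| ≤ C' * Real.exp (-δ * l1 (u - P')))
    (hS : ∀ κ u, BiLoc (S κ u) u u Cs δ) (hδ : 0 < δ) (hC : 0 ≤ C) (s : ℕ) [NeZero s] :
    BiLoc (fun x y a b => ∑ κ : Fin (d + 1),
        wsum (w κ) (fun u => fun x y a b => (∑' m : Fin (d + 1) → ℤ, w' κ (imageShift s u m)) * S κ u x y a b) x y a b)
      P P (∑ _κ : Fin (d + 1), C * (C' * Zl (d + 1) δ * Cs) * Zl (d + 1) (δ / 2)) (δ / 2) :=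
  OneStepResolventKernel.biLoc_finset_sum Finset.univ fun κ _ => biLoc_wsum (hw κ) (biLoc_per_mul hw' hS hδ s κ) hδ hC

/-- [folklore] **DIAGONAL SECOND ORDER, ENTRYWISE (F-g16-1 «WRAP» in its bond-diagonal form)**: with a second decaying weight family `w′` (centre `P′`,
same rate) PERIODISED inside,
`arr s (Σ_κ wsum (w κ) (u ↦ (Σ'_m w′ κ (u + s·m)) · S κ u)) x y a b = Σ_{k : I d n p} (r k · r′ k) · arr s (S κ′_k ŵ_k) x y a b`,
`r k := Σ'_m w κ′_k (ŵ_k + s·m)`, `r′ k := Σ'_m w′ κ′_k (ŵ_k + s·m)` — the product of the two torus responses AT THE SAME BOND is the window reading of the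
superposition with ONE weight periodised (not of `Σ_κ wsum (w κ · w′ κ) (S κ)`: the periodised product is not the product of the periodisations). -/
theorem arr_dirsum_wsum_per_apply (hw : ∀ κ u, |w κ u| ≤ C * Real.exp (-δ * l1 (u - P)))
    (hw' : ∀ κ u, |w' κ u| ≤ C' * Real.exp (-δ * l1 (u - P'))) (hS : ∀ κ u, BiLoc (S κ u) u u Cs δ)
    (hScov : ∀ κ u m, S κ (imageShift (n * p) u m) = shiftK (-(((n * p : ℕ) : ℤ) • m)) (S κ u)) (hδ : 0 < δ) (hC : 0 ≤ C)
    (x y : Fin (d + 1) → ℤ) (a b : F) :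
    arr (n * p) (fun x y a b => ∑ κ : Fin (d + 1),
        wsum (w κ) (fun u => fun x y a b => (∑' m : Fin (d + 1) → ℤ, w' κ (imageShift (n * p) u m)) * S κ u x y a b) x y a b) x y a b
      = ∑ k : Beta.Site (d + 1) p × (TorusSite (d + 1) n × Fin (d + 1)),
          ((∑' m : Fin (d + 1) → ℤ, w k.2.2 (imageShift (n * p) (windowMap (d + 1) (n * p) (torusBlockEquiv n p (k.1, k.2.1))) m))
            * (∑' m : Fin (d + 1) → ℤ, w' k.2.2 (imageShift (n * p) (windowMap (d + 1) (n * p) (torusBlockEquiv n p (k.1, k.2.1))) m)))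
            * arr (n * p) (S k.2.2 (windowMap (d + 1) (n * p) (torusBlockEquiv n p (k.1, k.2.1)))) x y a b := by
  have hC' : ∀ κ, 0 ≤ C' := fun κ => const_nonneg_of_weight (hw' κ)
  have hCs : 0 ≤ Cs := (hS 0 0).nonneg a
  -- the weighted family is LEFT-localised with an `s`-free constant and PERIOD-covariant
  have hK : ∀ κ u x y a b, |(fun u => fun x y a b => (∑' m : Fin (d + 1) → ℤ, w' κ (imageShift (n * p) u m)) * S κ u x y a b) u x y a b|
      ≤ (C' * Zl (d + 1) δ * Cs) * Real.exp (-δ * l1 (x - u)) :=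
    fun κ u x y a b => abs_le_left_of_biLoc (biLoc_per_mul hw' hS hδ (n * p) κ u) hδ.le x y a b
  have hKcov : ∀ κ u m, (fun u => fun x y a b => (∑' m : Fin (d + 1) → ℤ, w' κ (imageShift (n * p) u m)) * S κ u x y a b) (imageShift (n * p) u m)
      = shiftK (-(((n * p : ℕ) : ℤ) • m))
          ((fun u => fun x y a b => (∑' m : Fin (d + 1) → ℤ, w' κ (imageShift (n * p) u m)) * S κ u x y a b) u) := by
    intro κ u m
    funext x y a b
    simp only [shiftK]
    rw [periodisedWeight_periodic, hScov κ u m]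
    rfl
  rw [arr_finset_sum_apply Finset.univ (fun κ _ => biLoc_wsum (hw κ) (biLoc_per_mul hw' hS hδ (n * p) κ) hδ hC) (half_pos hδ) (n * p) x y a b,
    sum_bond_reindex (fun κ zz =>
      ((∑' m : Fin (d + 1) → ℤ, w κ (imageShift (n * p) (windowMap (d + 1) (n * p) zz) m))
        * (∑' m : Fin (d + 1) → ℤ, w' κ (imageShift (n * p) (windowMap (d + 1) (n * p) zz) m)))
        * arr (n * p) (S κ (windowMap (d + 1) (n * p) zz)) x y a b)]
  refine Finset.sum_congr rfl fun κ _ => ?_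
  rw [arr_wsum_eq_sum_window_left (s := n * p) (hw κ) (hK κ) (hKcov κ) hδ hC
    (mul_nonneg (mul_nonneg (hC' κ) (Zl_nonneg hδ)) hCs) x y a b]
  refine Finset.sum_congr rfl fun zz _ => ?_
  rw [arr_const_mul_apply, mul_assoc]

/-- [folklore] **DIAGONAL SECOND ORDER, TORUS-MATRIX FORM — «PACK-PLAIN₂»**:
`(arr s (Σ_κ wsum (w κ) (u ↦ w′_perˢ κ u · S κ u)))^ = Σ_{k : I d n p} (r k · r′ k) • (arr s (S κ′_k ŵ_k))^`. -/
theorem periodiseF_toF_arr_dirsum_wsum_per (hw : ∀ κ u, |w κ u| ≤ C * Real.exp (-δ * l1 (u - P)))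
    (hw' : ∀ κ u, |w' κ u| ≤ C' * Real.exp (-δ * l1 (u - P'))) (hS : ∀ κ u, BiLoc (S κ u) u u Cs δ)
    (hScov : ∀ κ u m, S κ (imageShift (n * p) u m) = shiftK (-(((n * p : ℕ) : ℤ) • m)) (S κ u)) (hδ : 0 < δ) (hC : 0 ≤ C) :
    Matrix.of (periodiseF (n * p) (toF (arr (n * p) (fun x y a b => ∑ κ : Fin (d + 1),
        wsum (w κ) (fun u => fun x y a b => (∑' m : Fin (d + 1) → ℤ, w' κ (imageShift (n * p) u m)) * S κ u x y a b) x y a b))))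
      = ∑ k : Beta.Site (d + 1) p × (TorusSite (d + 1) n × Fin (d + 1)),
          ((∑' m : Fin (d + 1) → ℤ, w k.2.2 (imageShift (n * p) (windowMap (d + 1) (n * p) (torusBlockEquiv n p (k.1, k.2.1))) m))
            * (∑' m : Fin (d + 1) → ℤ, w' k.2.2 (imageShift (n * p) (windowMap (d + 1) (n * p) (torusBlockEquiv n p (k.1, k.2.1))) m)))
            • Matrix.of (periodiseF (n * p) (toF (arr (n * p) (S k.2.2 (windowMap (d + 1) (n * p) (torusBlockEquiv n p (k.1, k.2.1))))))) := by
  ext ⟨x, a⟩ ⟨y, b⟩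
  rw [Matrix.sum_apply]
  simp only [Matrix.smul_apply, smul_eq_mul, Matrix.of_apply]
  exact periodiseF_finset_sum Finset.univ _
    (Li := fun k : Beta.Site (d + 1) p × (TorusSite (d + 1) n × Fin (d + 1)) =>
      toF (arr (n * p) (S k.2.2 (windowMap (d + 1) (n * p) (torusBlockEquiv n p (k.1, k.2.1))))))
    (fun I J => arr_dirsum_wsum_per_apply hw hw' hS hScov hδ hC I.1 J.1 I.2 J.2)
    (fun (k : Beta.Site (d + 1) p × (TorusSite (d + 1) n × Fin (d + 1))) _ a b x w =>
      summable_images_arr_fib (hS k.2.2 (windowMap (d + 1) (n * p) (torusBlockEquiv n p (k.1, k.2.1)))) hδ (n * p) a b x w) x y a b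

end Diagonal

/-! ## §4 The limit of the diagonal family as the period grows -/

section Limit

variable {w w' : Fin (d + 1) → (Fin (d + 1) → ℤ) → ℝ} {S : Fin (d + 1) → (Fin (d + 1) → ℤ) → MKer (d + 1) F} {C C' Cs δ : ℝ}
  {P P' : Fin (d + 1) → ℤ}

omit [NeZero n] [NeZero p] in
/-- [folklore] The stencil weighted by the PLAIN second weight, `u ↦ w′ κ u · S κ u`, is self-localised with constant `C′·Cs` (`|w′ κ u| ≤ C′`). -/
theorem biLoc_mul (hw' : ∀ κ u, |w' κ u| ≤ C' * Real.exp (-δ * l1 (u - P'))) (hS : ∀ κ u, BiLoc (S κ u) u u Cs δ) (hδ : 0 < δ)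
    (κ : Fin (d + 1)) (u : Fin (d + 1) → ℤ) :
    BiLoc (fun x y a b => w' κ u * S κ u x y a b) u u (C' * Cs) δ := by
  intro x y a b
  rw [abs_mul, mul_assoc]
  exact mul_le_mul (PeriodicArrayWrapLimit.abs_weight_le_const (hw' κ) hδ.le u) (hS κ u x y a b) (abs_nonneg _)
    (const_nonneg_of_weight (hw' κ))

omit [NeZero n] [NeZero p] in
/-- [folklore] LOCALISATION OF THE LIMIT FAMILY `Σ_κ wsum (w κ) (u ↦ w′ κ u · S κ u)` at `(P, P)` (rate `δ∕2`). -/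
theorem biLoc_dirsum_wsum_mul (hw : ∀ κ u, |w κ u| ≤ C * Real.exp (-δ * l1 (u - P))) (hw' : ∀ κ u, |w' κ u| ≤ C' * Real.exp (-δ * l1 (u - P')))
    (hS : ∀ κ u, BiLoc (S κ u) u u Cs δ) (hδ : 0 < δ) (hC : 0 ≤ C) :
    BiLoc (fun x y a b => ∑ κ : Fin (d + 1), wsum (w κ) (fun u => fun x y a b => w' κ u * S κ u x y a b) x y a b)
      P P (∑ _κ : Fin (d + 1), C * (C' * Cs) * Zl (d + 1) (δ / 2)) (δ / 2) :=
  OneStepResolventKernel.biLoc_finset_sum Finset.univ fun κ _ => biLoc_wsum (hw κ) (biLoc_mul hw' hS hδ κ) hδ hC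

omit [NeZero n] [NeZero p] in
/-- [folklore] **THE DIAGONAL FAMILY'S ENTRYWISE LIMIT (Tannery)**: along any sequence of periods `σ k → ∞`,
`Σ_κ wsum (w κ) (u ↦ w′_per^{σ k} κ u · S κ u) x y a b → Σ_κ wsum (w κ) (u ↦ w′ κ u · S κ u) x y a b`
(termwise by gan24-leaf-05's «WRAP-LIMIT» `tendsto_tsum_images`; dominated by `|w κ u|·C′·Zl δ·Cs·e^{−δ|x−u|₁}`, summable in `u`). -/
theorem tendsto_dirsum_wsum_per_apply (hw : ∀ κ u, |w κ u| ≤ C * Real.exp (-δ * l1 (u - P)))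
    (hw' : ∀ κ u, |w' κ u| ≤ C' * Real.exp (-δ * l1 (u - P'))) (hS : ∀ κ u, BiLoc (S κ u) u u Cs δ) (hδ : 0 < δ) (hC : 0 ≤ C)
    {σ : ℕ → ℕ} (hσ : Tendsto σ atTop atTop) (x y : Fin (d + 1) → ℤ) (a b : F) :
    Tendsto (fun k => ∑ κ : Fin (d + 1),
        wsum (w κ) (fun u => fun x y a b => (∑' m : Fin (d + 1) → ℤ, w' κ (imageShift (σ k) u m)) * S κ u x y a b) x y a b) atTop
      (𝓝 (∑ κ : Fin (d + 1), wsum (w κ) (fun u => fun x y a b => w' κ u * S κ u x y a b) x y a b)) := by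
  have hC' : ∀ κ, 0 ≤ C' := fun κ => const_nonneg_of_weight (hw' κ)
  have hCs : 0 ≤ Cs := (hS 0 0).nonneg a
  refine tendsto_finsetSum _ fun κ _ => ?_
  unfold wsum
  refine tendsto_tsum_of_dominated_convergence
    (bound := fun u => C * (C' * Zl (d + 1) δ * Cs) * Real.exp (-(δ / 2) * (l1 (x - P) + l1 (y - P))) * Real.exp (-(δ / 2) * l1 (x - u)))
    ?_ ?_ ?_
  · exact (summable_exp_shift (half_pos hδ) x).mul_left _
  · intro u
    -- termwise: the periodised weight tends to the weight (eventually `σ k ≥ 1`)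
    have h1 : Tendsto (fun k => ∑' m : Fin (d + 1) → ℤ, w' κ (imageShift (σ k) u m)) atTop (𝓝 (w' κ u)) :=
      (tendsto_tsum_images (hw' κ) hδ u).comp hσ
    exact ((h1.mul_const _).const_mul _)
  · filter_upwards [hσ.eventually_ge_atTop 1] with k hk u
    haveI : NeZero (σ k) := ⟨by omega⟩
    rw [Real.norm_eq_abs]
    exact abs_wsumTerm_le (hw κ) (biLoc_per_mul hw' hS hδ (σ k) κ) hδ.le hC x y a b u

end Limit

end Summit.QuantumFields.BalabanUV.Beta.D1BFx.PeriodicArrayPackingPlain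

end
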